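import Literature.NumberTheory.GaloisRepresentations.LocalUnramifiedNormGroups
import Literature.Algebra.Homology.UnramifiedClassModule
import HarnessLib

/-!
# The valuation `v_L : Lˣ → ℤ` of a finite separable `L ⊆ F̄` over a non-archimedean local field,
# as a morphism `Rep.ofAlgebraAutOnUnits F L ⟶ Rep.trivial ℤ Gal(L/F) ℤ` — the `v` of the engine's
# unramified class modules (Neukirch, *Bonn Lectures* II §4; Serre, *Local Fields* II §2, XIII §3)

Topic `NumberTheory/GaloisRepresentations` (local class field theory); namespace
`Literature.NumberTheory.GaloisRepresentations.LocalWeilDatum`.  One definition with body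
(`unitsValuation`, the normalised valuation on units as a morphism of representations) and its
unfolding / surjectivity / kernel lemmas; NO named fact, no instance, no notation, no `sorry`.

The engine `Literature/Algebra/Homology/UnramifiedClassModule` formalises an unramified layer
ABSTRACTLY: `Unramified.IsUnramified σ A v ϖ` for a `Gal`-module `A`, a morphism
`v : A ⟶ Rep.trivial ℤ G ℤ` ("the valuation `v_L`") with cohomologically trivial kernel (the units),
and an invariant `ϖ` with `v ϖ = 1`; from it the class module of the layer, the Frobenius cocycle and
the invariant map `inv(u_{L|K}) = 1/[L:K]` (Neukirch II §4 (4.3)–(4.6)).  This file supplies the `v`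
for the layers of a non-archimedean local field `F` in the tree's Weil-datum dialect
(`LocalUnramifiedNormGroups`: `tVal F L a = ord_F(N_{L/F} a) = f_L · v_L(a)`, `fDeg F L = f_L`):

* `unitsValuation F L hLs : Rep.ofAlgebraAutOnUnits F L ⟶ Rep.trivial ℤ (L ≃ₐ[F] L) ℤ`,
  `u ↦ v_L(u) = t_L(u) / f_L` (`ℤ`-valued: `f_L ∣ t_L`, `fDeg_dvd_tVal`; `Gal(L/F)`-invariant:
  `N_{L/F}(σ u) = N_{L/F}(u)`, Mathlib `Algebra.norm_eq_of_algEquiv`), with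
  `unitsValuation_apply`, `fDeg_mul_unitsValuation` (`f_L · v_L(u) = t_L(u)`),
  `exists_unitsValuation_eq_one` / `unitsValuation_surjective` (a uniformiser, `exists_tVal_eq_fDeg`),
  `mem_ker_unitsValuation_iff` (`v_L(u) = 0 ↔ t_L(u) = 0`: the units of valuation zero).
* For a sub-layer `L/K`, `K ≤ L`, the layer's module is the restriction of `Rep.ofAlgebraAutOnUnits F L`
  along `Gal(L/K) ↪ Gal(L/F)` (`AlgEquiv.restrictScalars`), and `v` restricts with it; no `K`-algebra
  structure on `L` is needed here.

What this is NOT: the unramified layers themselves (`IsUnramified` for `K_m/K`: Frobenius generator,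
`v(π_K) = 1`, cohomological triviality of the units — the plan (A2)–(A3) of memo
`FINDING-door-c6-g8-cyclic-class-modules.md` §4).

## References
* J. Neukirch, *Class Field Theory — The Bonn Lectures* (2013), II §4 (4.3)–(4.6). [Neukirch2013]
* J.-P. Serre, *Local Fields*, GTM 67 (1979), II §2 Cor. 3 (`f ∣ v(N x)`), XIII §3. [SerreLocalFields1979]
-/

noncomputable section

open CategoryTheory

namespace Literature.NumberTheory.GaloisRepresentations

namespace LocalWeilDatum

open IsNonarchimedeanLocalField IntermediateField

variable (F : Type) [Field F] [ValuativeRel F] [TopologicalSpace F] [IsNonarchimedeanLocalField F]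
variable (L : IntermediateField F (AlgebraicClosure F)) [FiniteDimensional F L]

omit [FiniteDimensional F L] in
/-- `t_L(σ u) = t_L(u)` for `σ ∈ Gal(L/F)`: the norm to `F` is invariant under `F`-automorphisms.
[cite: SerreLocalFields1979, Ch. II §2 Cor. 3] -/
theorem tVal_algEquiv (σ : L ≃ₐ[F] L) (a : L) : tVal F L (σ a) = tVal F L a := by
  unfold tVal
  rw [Algebra.norm_eq_of_algEquiv σ a]

/-- `t_L(u⁻¹ v) …`: `t_L` on units is a homomorphism to `ℤ` (`t_L(uv) = t_L(u) + t_L(v)`).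
[cite: SerreLocalFields1979, Ch. II §2] -/
theorem tVal_units_mul (u v : Lˣ) :
    tVal F L ((u * v : Lˣ) : L) = tVal F L (u : L) + tVal F L (v : L) := by
  rw [Units.val_mul, tVal_mul F L u.ne_zero v.ne_zero]

variable (hLs : L ≤ sepClosure F)

include hLs in
/-- `f_L · (t_L(u) / f_L) = t_L(u)` on units (`f_L ∣ t_L(u)`). [cite: SerreLocalFields1979, Ch. II §2 Cor. 3] -/
theorem fDeg_mul_tVal_div (u : Lˣ) :
    (fDeg F L : ℤ) * (tVal F L (u : L) / fDeg F L) = tVal F L (u : L) :=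
  Int.mul_ediv_cancel' (fDeg_dvd_tVal F L hLs u.ne_zero)

/-- **The valuation `v_L` on units as a morphism of representations**
`Rep.ofAlgebraAutOnUnits F L ⟶ Rep.trivial ℤ Gal(L/F) ℤ`, `u ↦ t_L(u) / f_L` — the `v : A → ℤ` of the
engine's unramified class modules for the layers of a non-archimedean local field (`Gal(L/F)`-invariant
by `tVal_algEquiv`; additive by `tVal_units_mul` and `f_L ∣ t_L`).
[cite: Neukirch2013, Part II §4 (before Def. (4.5))][cite: SerreLocalFields1979, Ch. XIII §3] -/
def unitsValuation : Rep.ofAlgebraAutOnUnits F L ⟶ Rep.trivial ℤ (L ≃ₐ[F] L) ℤ :=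
  Rep.ofHom
    ⟨(AddMonoidHom.mk' (fun a : Additive Lˣ => tVal F L ((Additive.toMul a : Lˣ) : L) / fDeg F L)
        (fun a b => by
          rw [toMul_add, tVal_units_mul]
          exact Int.add_ediv_of_dvd_left (fDeg_dvd_tVal F L hLs (Additive.toMul a).ne_zero))).toIntLinearMap,
      fun σ => LinearMap.ext fun a => by
        change tVal F L (((σ • (Additive.toMul a : Lˣ) : Lˣ) : L)) / fDeg F L =
          tVal F L ((Additive.toMul a : Lˣ) : L) / fDeg F L
        change tVal F L (σ ((Additive.toMul a : Lˣ) : L)) / fDeg F L = _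
        rw [tVal_algEquiv]⟩

/-- Unfolding: `v_L(u) = t_L(u) / f_L`. [cite: Neukirch2013, Part II §4] -/
theorem unitsValuation_apply (a : Additive Lˣ) :
    (unitsValuation F L hLs).hom a = tVal F L ((Additive.toMul a : Lˣ) : L) / fDeg F L := rfl

/-- `f_L · v_L(u) = t_L(u)`. [cite: SerreLocalFields1979, Ch. II §2 Cor. 3] -/
theorem fDeg_mul_unitsValuation (a : Additive Lˣ) :
    (fDeg F L : ℤ) * (unitsValuation F L hLs).hom a = tVal F L ((Additive.toMul a : Lˣ) : L) := by
  rw [unitsValuation_apply]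
  exact fDeg_mul_tVal_div F L hLs _

/-- **`v_L(u) = 0 ↔ t_L(u) = 0`**: the kernel of `v_L` is the group of units of valuation zero.
[cite: Neukirch2013, Part II §4 ("`1 → U_L → L^× → ℤ → 0`")] -/
theorem unitsValuation_eq_zero_iff (a : Additive Lˣ) :
    (unitsValuation F L hLs).hom a = 0 ↔ tVal F L ((Additive.toMul a : Lˣ) : L) = 0 := by
  constructor
  · intro h
    rw [← fDeg_mul_unitsValuation F L hLs a, h, mul_zero]
  · intro h
    rw [unitsValuation_apply, h, Int.zero_ediv]

/-- **A uniformiser: `v_L(π_L) = 1`** (an element with `t_L = f_L`, `exists_tVal_eq_fDeg`).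
[cite: SerreLocalFields1979, Ch. II §2 Cor. 3] -/
theorem exists_unitsValuation_eq_one : ∃ a : Additive Lˣ, (unitsValuation F L hLs).hom a = 1 := by
  obtain ⟨x, hx, htx⟩ := exists_tVal_eq_fDeg F L hLs
  refine ⟨Additive.ofMul (Units.mk0 x hx), ?_⟩
  rw [unitsValuation_apply]
  change tVal F L x / fDeg F L = 1
  rw [htx]
  exact Int.ediv_self (by exact_mod_cast (fDeg_pos F L).ne')

/-- `v_L` is onto `ℤ`. [cite: Neukirch2013, Part II §4 (before Def. (4.5))] -/
theorem unitsValuation_surjective : Function.Surjective (unitsValuation F L hLs).hom := by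
  obtain ⟨a, ha⟩ := exists_unitsValuation_eq_one F L hLs
  exact Literature.Algebra.Homology.Unramified.surjective_of_map_eq_one _ _ a ha

end LocalWeilDatum

end Literature.NumberTheory.GaloisRepresentations

end
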